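import Summits.BirchSwinnertonDyer.BirchSwinnertonDyer.Theorems.RamifiedSevenEllipticUnitsRelaxedSelmerSaturation
import Summits.BirchSwinnertonDyer.BirchSwinnertonDyer.Theorems.RamifiedSevenEllipticUnitsBottomLocalIndexSplit
import Summits.BirchSwinnertonDyer.BirchSwinnertonDyer.Theorems.RamifiedSevenEllipticUnitsBottomClassRelative
import HarnessLib

set_option linter.dupNamespace false
set_option autoImplicit false

/-!
# Route `RamifiedSevenEllipticUnits` (rung K7r), value crux (19705 → its E-Zp successor
# `EllipticUnitValueSevenOfGZK`), line `rubin-formula-zp`, stub S_sat — the RANK HALF of S_sat is free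
# over the corrected carrier: **`[S_{p,rel} : S_p] ∣ p^c`, hence `S_{p,rel}(E/K) = S_p(E/K)`, from the
# bottom index exponent `hcZp`, `z(𝟙) ∈ S_p(E/K)` and `T_pШ(E/K) = 0`** (PROVED; `--supports 19705`)

Cell `bsd-cm`, seat `bsd-cm-k7r-c2` g5 (CLAIM on STATUS 2026-08-26T21:1xZ). HONEST FRAMING: subgroup
algebra over landed carrier lemmas; nothing about any curve's arithmetic is asserted; BSD is not proved;
no named fact is minted; every theorem is `sorry`-free.

## What this file removes from the line card

The line card `Lines/rubin-formula-zp.md` (k7r-c4 g5, signed by k7r-c2 g4 / k7r-c3) splits the stub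
S_sat «`S_{p,rel}(E/K) ≤ E(K) ⊗ ℤ_p`» into (S_sat-loc) `S_rel/S_p` torsion-free (PROVED, p466833),
(S_sat-rk) `[S_rel : S_p] < ∞` — «EITHER Poitou–Tate (global duality, not in the tree) OR the GZK-free
algebraic route: `hcZp ∧ rank_ℤ End_K(E) ≤ 2 ∧` Mattuck» — and (S_sat-MW) `S_p ≤ E(K) ⊗ ℤ_p` (`T_pШ = 0`).
THIS FILE: **(S_sat-rk) needs neither global duality nor the two algebraic inputs.** In the ALTERNATIVE
form of S_sat (the datum `D` and its bottom index exponent `c` are binders of the crux body, so they are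
available to the stub) one has, for the `p`-adic span `Z = 𝒪_𝔭 · z(𝟙)` (`padicEndSpan`):

* `hcZp : [S_rel : tors ⊔ Z] = p^c` (`EllipticUnitClassData.HasBottomIndexExpZp`);
* `Z ≤ S_p(E/K)` as soon as `z(𝟙) ∈ E(K) ⊗ ℤ_p` (the Mordell–Weil Kummer span is `End_K`- and
  `ℤ_p`-stable, `BottomLocalIndexSplit.padicEndSpan_le_mordellWeilKummerSpan`, p465731, and lies in
  `S_p(E/K)`, `KummerFamiliesSelmer.mordellWeilKummerSpan_le_compactSelmerOver`, p464144) — and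
  `z(𝟙) ∈ E(K) ⊗ ℤ_p` follows from `z(𝟙) ∈ S_p(E/K)` ([BKNO] Lemma 7.1 at `χ = 𝟙`: the landed
  `BottomClass.bottom_mem_compactSelmerOver` under its binder `hvan`) and (S_sat-MW);
* `tors(S_rel) ≤ S_p(E/K)`: a torsion element of `S_rel` has the multiple `0 ∈ S_p`, so it lies in `S_p`
  by saturation (`RelaxedSelmerSaturation.mem_compactSelmerOver_of_nsmul_mem`, p466833).

Hence `S_rel ⊓ (tors ⊔ Z) ≤ S_p ≤ S_rel`, so `[S_rel : S_p]` divides `[S_rel : S_rel ⊓ (tors ⊔ Z)] = p^c`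
(`AddSubgroup.relIndex_dvd_of_le_left`, `AddSubgroup.inf_relIndex_right`), is non-zero, and
`S_rel = S_p` (`RelaxedSelmerSaturation.relaxedCompactSelmerOver_eq_of_relIndex_ne_zero`). So:

**S_sat(alt) = `hcZp` ∧ `z(𝟙) ∈ S_p(E/K)` ∧ (S_sat-MW)**, and its only arithmetic input is
`T_pШ(E/K) = 0` (⟸ GZK for `W`, `W'` + the tree's odd-part quadratic descent of `Ш`), the subject of the
sibling files of this seat. READING: `S_rel/tors` is a torsion-free `𝒪_𝔭`-module in which `𝒪_𝔭 · z(𝟙)` has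
finite index, so ANY saturated submodule containing `z(𝟙)` is everything — the rank count of the card is
replaced by the index `p^c` the crux already quantifies over.

## Main results (namespace `…Theorems.RamifiedSevenEllipticUnits.RelaxedEqCompact`)

* `inf_sup_le_compactSelmerOver` — `S_rel ⊓ (tors ⊔ Z) ≤ S_p` for every `Z ≤ S_p` (any number field, any
  relaxed set `P`, bottom layer of any `ℤ_p`-tower).
* `relIndex_compact_relaxed_dvd`, `relIndex_compact_relaxed_ne_zero_of_relIndex_eq_pow` — `[S_rel : S_p] ∣
  [S_rel : tors ⊔ Z]`; `= p^c ⇒ ≠ 0`.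
* `relaxed_eq_compact_of_relIndex_eq_pow`, `relaxed_le_of_relIndex_eq_pow` — `S_rel = S_p`, and
  `S_rel ≤ N` whenever `S_p ≤ N`.
* `relaxed_le_mordellWeilKummerSpan_of_hasBottomIndexExpZp` — the datum form: `hcZp → z(𝟙) ∈ S_p(E/K) →
  (S_p ≤ E(K) ⊗ ℤ_p) → S_rel ≤ E(K) ⊗ ℤ_p` (= the conclusion of `X12.O11.RamifiedCMBottomSaturationAt` at
  that frame); `…_of_hvan` — the same with `z(𝟙) ∈ S_p` discharged by B1 under `hvan`.

References: [BKNO] arXiv:2608.06879v1 §3.1.2, §3.3.1, Lemma 7.1 [BurungaleKobayashiNakamuraOta2026];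
B. Perrin-Riou, Bull. SMF 115 (1987) §0 pp. 401–402 (`0 → E(L) ⊗ ℤ_p → S_p(L) → T_pШ → 0`)
[PerrinRiou1987BSMF]; S. Bloch, K. Kato (1990) §3 Ex. 3.11 [BlochKato1990]; cell texts
`Lines/rubin-formula-zp.md`, MEMO-k7r-c4-g5-CARRIER.md §5, SB4-RECUT.md §2, STATUS D117 (3)/(A2).
-/

noncomputable section

open scoped Classical

open WeierstrassCurve NumberField IsDedekindDomain Field
  Literature.NumberTheory.EllipticCurves
  Literature.NumberTheory.GaloisRepresentations
  Literature.NumberTheory.EllipticCurves.BurungaleKobayashiNakamuraOta2026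

universe u

namespace Summit.BirchSwinnertonDyer.BirchSwinnertonDyer.Theorems.RamifiedSevenEllipticUnits

namespace RelaxedEqCompact

/-! ## Part 1. Subgroup algebra at the bottom layer of a `ℤ_p`-tower over a number field -/

section Bottom

variable {K : Type u} [Field K] [NumberField K] (V : WeierstrassCurve K) (p : ℕ) [Fact p.Prime]
  (κ : ZpExtension K p)

/-- **Torsion elements of `S_{p,rel}(E/K)` lie in `S_p(E/K)`**: a class `t ∈ S_rel` with `n • t = 0`,
`n ≠ 0`, has the multiple `n • t = 0 ∈ S_p`, so `t ∈ S_p` by the saturation of `S_p` in `S_rel`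
(`RelaxedSelmerSaturation.mem_compactSelmerOver_of_nsmul_mem`, p466833: `S_rel/S_p ↪ T_p H¹(K_𝔭, E)` is
torsion-free). [cite: BlochKato1990, §3 Example 3.11 (`H¹_f` is saturated; shape only)]
[cite: PerrinRiou1987BSMF, §0 p. 401] -/
theorem mem_compactSelmerOver_of_isOfFinAddOrder {P : Set (HeightOneSpectrum (𝓞 K))}
    {t : V.torsionH1Pi p (κ.layerSubgroup 0)}
    (ht : t ∈ V.relaxedCompactSelmerOver (κ.layerSubgroup 0) p P) (hfin : IsOfFinAddOrder t) :
    t ∈ V.compactSelmerOver (κ.layerSubgroup 0) p := by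
  obtain ⟨n, hn, hnt⟩ := (isOfFinAddOrder_iff_nsmul_eq_zero).1 hfin
  exact RelaxedSelmerSaturation.mem_compactSelmerOver_of_nsmul_mem V p κ ht hn.ne'
    (by rw [hnt]; exact zero_mem _)

/-- **`S_rel ⊓ (tors ⊔ Z) ≤ S_p` for every subgroup `Z ≤ S_p(E/K)`**: an element `s = t + u` of `S_rel`
with `t` torsion (in the ambient `∏_k H¹(K, E[p^k])`) and `u ∈ Z ≤ S_p ≤ S_rel` has `t = s - u ∈ S_rel`
torsion, hence `t ∈ S_p` (previous lemma), hence `s ∈ S_p`. [cite: PerrinRiou1987BSMF, §0 pp. 401–402 (the groups `S_p(L)`; shape only)] -/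
theorem inf_sup_le_compactSelmerOver (P : Set (HeightOneSpectrum (𝓞 K)))
    {Z : AddSubgroup (V.torsionH1Pi p (κ.layerSubgroup 0))}
    (hZ : Z ≤ V.compactSelmerOver (κ.layerSubgroup 0) p) :
    V.relaxedCompactSelmerOver (κ.layerSubgroup 0) p P ⊓
        (AddCommGroup.torsion (V.torsionH1Pi p (κ.layerSubgroup 0)) ⊔ Z) ≤
      V.compactSelmerOver (κ.layerSubgroup 0) p := by
  intro s hs'
  have hs : s ∈ V.relaxedCompactSelmerOver (κ.layerSubgroup 0) p P := (AddSubgroup.mem_inf.1 hs').1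
  have hsup : s ∈ AddCommGroup.torsion (V.torsionH1Pi p (κ.layerSubgroup 0)) ⊔ Z :=
    (AddSubgroup.mem_inf.1 hs').2
  obtain ⟨t, ht, u, hu, htu⟩ := AddSubgroup.mem_sup.1 hsup
  have huS : u ∈ V.compactSelmerOver (κ.layerSubgroup 0) p := hZ hu
  have htrel : t ∈ V.relaxedCompactSelmerOver (κ.layerSubgroup 0) p P := by
    have h := sub_mem hs (V.compactSelmerOver_le_relaxedCompactSelmerOver _ p P huS)
    rwa [← htu, add_sub_cancel_right] at h
  rw [← htu]
  exact add_mem (mem_compactSelmerOver_of_isOfFinAddOrder V p κ htrel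
    ((AddCommGroup.mem_torsion t).1 ht)) huS

/-- **`[S_{p,rel} : S_p]` divides `[S_{p,rel} : tors ⊔ Z]`** for every `Z ≤ S_p(E/K)` (relative indices
inside `S_rel`; `AddSubgroup.relIndex`, `0` = infinite index): `S_rel ⊓ (tors ⊔ Z) ≤ S_p`
(`inf_sup_le_compactSelmerOver`) and `[S_rel : S_rel ⊓ (tors ⊔ Z)] = [S_rel : tors ⊔ Z]`.
[cite: PerrinRiou1987BSMF, §0 pp. 401–402 (shape only)] -/
theorem relIndex_compact_relaxed_dvd (P : Set (HeightOneSpectrum (𝓞 K)))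
    {Z : AddSubgroup (V.torsionH1Pi p (κ.layerSubgroup 0))}
    (hZ : Z ≤ V.compactSelmerOver (κ.layerSubgroup 0) p) :
    (V.compactSelmerOver (κ.layerSubgroup 0) p).relIndex
        (V.relaxedCompactSelmerOver (κ.layerSubgroup 0) p P) ∣
      (AddCommGroup.torsion (V.torsionH1Pi p (κ.layerSubgroup 0)) ⊔ Z).relIndex
        (V.relaxedCompactSelmerOver (κ.layerSubgroup 0) p P) := by
  rw [← AddSubgroup.inf_relIndex_right
    (AddCommGroup.torsion (V.torsionH1Pi p (κ.layerSubgroup 0)) ⊔ Z), inf_comm]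
  exact AddSubgroup.relIndex_dvd_of_le_left _ (inf_sup_le_compactSelmerOver V p κ P hZ)

/-- **A finite bottom index forces `[S_{p,rel} : S_p] ≠ 0`**: if `[S_rel : tors ⊔ Z] = p^c` for some
`Z ≤ S_p(E/K)` then `[S_rel : S_p] ∣ p^c ≠ 0`. [cite: BurungaleKobayashiNakamuraOta2026, §3.3.1 (arXiv:2608.06879 p. 19) (the module `𝒪·z(𝟙)` of finite index; shape only)] -/
theorem relIndex_compact_relaxed_ne_zero_of_relIndex_eq_pow (P : Set (HeightOneSpectrum (𝓞 K)))
    {Z : AddSubgroup (V.torsionH1Pi p (κ.layerSubgroup 0))}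
    (hZ : Z ≤ V.compactSelmerOver (κ.layerSubgroup 0) p) {c : ℕ}
    (hc : (AddCommGroup.torsion (V.torsionH1Pi p (κ.layerSubgroup 0)) ⊔ Z).relIndex
      (V.relaxedCompactSelmerOver (κ.layerSubgroup 0) p P) = p ^ c) :
    (V.compactSelmerOver (κ.layerSubgroup 0) p).relIndex
        (V.relaxedCompactSelmerOver (κ.layerSubgroup 0) p P) ≠ 0 := by
  intro h0
  have hdvd := relIndex_compact_relaxed_dvd V p κ P hZ
  rw [h0, hc, zero_dvd_iff] at hdvd
  exact pow_ne_zero c (Fact.out : p.Prime).ne_zero hdvd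

/-- **`S_{p,rel}(E/K) = S_p(E/K)` from a finite bottom index over a sublattice of `S_p`**: combine the
previous theorem with the saturation corollary
`RelaxedSelmerSaturation.relaxedCompactSelmerOver_eq_of_relIndex_ne_zero` (p466833). This is the
(S_sat-rk) ∧ (S_sat-loc) half of the line card's S_sat — «relaxed = compact at the bottom» — with NO
global duality. [cite: BurungaleKobayashiNakamuraOta2026, §3.1.2 and §3.3.1 (arXiv:2608.06879 pp. 16, 19) (shape only)]
[cite: BlochKato1990, §3 Example 3.11] -/
theorem relaxed_eq_compact_of_relIndex_eq_pow (P : Set (HeightOneSpectrum (𝓞 K)))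
    {Z : AddSubgroup (V.torsionH1Pi p (κ.layerSubgroup 0))}
    (hZ : Z ≤ V.compactSelmerOver (κ.layerSubgroup 0) p) {c : ℕ}
    (hc : (AddCommGroup.torsion (V.torsionH1Pi p (κ.layerSubgroup 0)) ⊔ Z).relIndex
      (V.relaxedCompactSelmerOver (κ.layerSubgroup 0) p P) = p ^ c) :
    V.relaxedCompactSelmerOver (κ.layerSubgroup 0) p P = V.compactSelmerOver (κ.layerSubgroup 0) p :=
  RelaxedSelmerSaturation.relaxedCompactSelmerOver_eq_of_relIndex_ne_zero V p κ P
    (relIndex_compact_relaxed_ne_zero_of_relIndex_eq_pow V p κ P hZ hc)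

/-- **Hence `S_{p,rel}(E/K) ≤ N` whenever `S_p(E/K) ≤ N`** (intended `N = E(K) ⊗ ℤ_p`, the conclusion
(sat) of S_sat): the index hypothesis over a sublattice `Z ≤ S_p` and (S_sat-MW) give (sat).
[cite: PerrinRiou1987BSMF, §0 pp. 401–402 (`0 → E(L) ⊗ ℤ_p → S_p(L) → T_pШ → 0`; shape only)] -/
theorem relaxed_le_of_relIndex_eq_pow (P : Set (HeightOneSpectrum (𝓞 K)))
    {Z N : AddSubgroup (V.torsionH1Pi p (κ.layerSubgroup 0))}
    (hZ : Z ≤ V.compactSelmerOver (κ.layerSubgroup 0) p) {c : ℕ}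
    (hc : (AddCommGroup.torsion (V.torsionH1Pi p (κ.layerSubgroup 0)) ⊔ Z).relIndex
      (V.relaxedCompactSelmerOver (κ.layerSubgroup 0) p P) = p ^ c)
    (hN : V.compactSelmerOver (κ.layerSubgroup 0) p ≤ N) :
    V.relaxedCompactSelmerOver (κ.layerSubgroup 0) p P ≤ N := by
  rw [relaxed_eq_compact_of_relIndex_eq_pow V p κ P hZ hc]
  exact hN

/-- **The Mordell–Weil variant**: if `[S_rel : tors ⊔ 𝒪_𝔭 · x] = p^c` for a class `x ∈ E(K) ⊗ ℤ_p`
(`mordellWeilKummerSpan` at the bottom layer; `𝒪_𝔭 · x = padicEndSpan x`), and `S_p(E/K) ≤ E(K) ⊗ ℤ_p`,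
then `S_{p,rel}(E/K) ≤ E(K) ⊗ ℤ_p`: `𝒪_𝔭 · x ≤ E(K) ⊗ ℤ_p`
(`BottomLocalIndexSplit.padicEndSpan_le_mordellWeilKummerSpan`, p465731) `≤ S_p(E/K)`
(`KummerFamiliesSelmer.mordellWeilKummerSpan_le_compactSelmerOver`, p464144).
[cite: BurungaleKobayashiNakamuraOta2026, §3.3.1 (arXiv:2608.06879 p. 19) (the module `𝒪·z(𝟙)`; shape only)]
[cite: PerrinRiou1987BSMF, §0 pp. 401–402] -/
theorem relaxed_le_mordellWeilKummerSpan_of_relIndex_padicEndSpan_eq_pow [V.IsElliptic]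
    (P : Set (HeightOneSpectrum (𝓞 K))) {x : V.torsionH1Pi p (κ.layerSubgroup 0)}
    (hx : x ∈ V.mordellWeilKummerSpan p (κ.layerSubgroup 0)) {c : ℕ}
    (hc : (AddCommGroup.torsion (V.torsionH1Pi p (κ.layerSubgroup 0)) ⊔
        V.padicEndSpan p (κ.layerSubgroup 0) x).relIndex
      (V.relaxedCompactSelmerOver (κ.layerSubgroup 0) p P) = p ^ c)
    (hMW : V.compactSelmerOver (κ.layerSubgroup 0) p ≤ V.mordellWeilKummerSpan p (κ.layerSubgroup 0)) :
    V.relaxedCompactSelmerOver (κ.layerSubgroup 0) p P ≤ V.mordellWeilKummerSpan p (κ.layerSubgroup 0) :=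
  relaxed_le_of_relIndex_eq_pow V p κ P
    ((BottomLocalIndexSplit.padicEndSpan_le_mordellWeilKummerSpan V p (κ.layerSubgroup 0) hx).trans
      (KummerFamiliesSelmer.mordellWeilKummerSpan_le_compactSelmerOver V p κ))
    hc hMW

end Bottom

/-! ## Part 2. The datum form: S_sat(alt) from `hcZp`, `z(𝟙) ∈ S_p(E/K)` and `T_pШ(E/K) = 0` -/

section Datum

variable {W : WeierstrassCurve ℚ} [W.IsElliptic] {p : ℕ} [Fact p.Prime]
  {K : Type} [Field K] [NumberField K] {𝔭 : HeightOneSpectrum (𝓞 K)} {κ : ZpExtension K p}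
  {γ : absoluteGaloisGroup K} {ι : PadicAlgCl p ≃+* ℂ} {φ : HeckeCharacter K} {Ω : ℂ}
  {𝓔 : AcDualExpSystem W p K 𝔭 κ ι}

/-- **S_sat(alt), step 1: `[S_{p,rel}(E/K) : S_p(E/K)] ≠ 0` from the bottom index exponent and
`z(𝟙) ∈ S_p(E/K)`**, GIVEN (S_sat-MW) `S_p(E/K) ≤ E(K) ⊗ ℤ_p`: then `z(𝟙) ∈ E(K) ⊗ ℤ_p`, so
`𝒪_𝔭 · z(𝟙) ≤ E(K) ⊗ ℤ_p ≤ S_p(E/K)` and `relIndex_compact_relaxed_ne_zero_of_relIndex_eq_pow` applies to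
`hcZp : [S_rel : tors ⊔ 𝒪_𝔭 · z(𝟙)] = p^c` (`EllipticUnitClassData.HasBottomIndexExpZp`, p465174).
[cite: BurungaleKobayashiNakamuraOta2026, §3.3.1 and Lemma 7.1 (arXiv:2608.06879 pp. 19, 40) (claim; preprint; shape only)] -/
theorem relIndex_compact_relaxed_ne_zero_of_hasBottomIndexExpZp
    (D : EllipticUnitClassData W p K 𝔭 κ γ ι φ Ω 𝓔) {c : ℕ} (hc : D.HasBottomIndexExpZp c)
    (hz : D.z 0 ∈ (W.baseChange K).compactSelmerOver (κ.layerSubgroup 0) p)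
    (hMW : (W.baseChange K).compactSelmerOver (κ.layerSubgroup 0) p ≤
      (W.baseChange K).mordellWeilKummerSpan p (κ.layerSubgroup 0)) :
    ((W.baseChange K).compactSelmerOver (κ.layerSubgroup 0) p).relIndex
        ((W.baseChange K).relaxedCompactSelmerOver (κ.layerSubgroup 0) p {𝔭}) ≠ 0 :=
  haveI : (W.baseChange K).IsElliptic := inferInstanceAs (W.map (algebraMap ℚ K)).IsElliptic
  relIndex_compact_relaxed_ne_zero_of_relIndex_eq_pow (W.baseChange K) p κ {𝔭}
    ((BottomLocalIndexSplit.padicEndSpan_le_mordellWeilKummerSpan (W.baseChange K) p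
        (κ.layerSubgroup 0) (hMW hz)).trans
      (KummerFamiliesSelmer.mordellWeilKummerSpan_le_compactSelmerOver (W.baseChange K) p κ))
    hc

/-- **S_sat(alt), step 2: `S_{p,rel}(E/K) = S_p(E/K)`** («relaxed = compact at the bottom») from
`hcZp`, `z(𝟙) ∈ S_p(E/K)` and (S_sat-MW) — the (S_sat-rk) ∧ (S_sat-loc) half of the line card's S_sat
with no global duality and no rank count. [cite: BurungaleKobayashiNakamuraOta2026, §3.1.2, §3.3.1 and Lemma 7.1 (arXiv:2608.06879 pp. 16, 19, 40) (claim; preprint; shape only)]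
[cite: BlochKato1990, §3 Example 3.11] -/
theorem relaxed_eq_compact_of_hasBottomIndexExpZp
    (D : EllipticUnitClassData W p K 𝔭 κ γ ι φ Ω 𝓔) {c : ℕ} (hc : D.HasBottomIndexExpZp c)
    (hz : D.z 0 ∈ (W.baseChange K).compactSelmerOver (κ.layerSubgroup 0) p)
    (hMW : (W.baseChange K).compactSelmerOver (κ.layerSubgroup 0) p ≤
      (W.baseChange K).mordellWeilKummerSpan p (κ.layerSubgroup 0)) :
    (W.baseChange K).relaxedCompactSelmerOver (κ.layerSubgroup 0) p {𝔭} =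
      (W.baseChange K).compactSelmerOver (κ.layerSubgroup 0) p :=
  RelaxedSelmerSaturation.relaxedCompactSelmerOver_eq_of_relIndex_ne_zero (W.baseChange K) p κ {𝔭}
    (relIndex_compact_relaxed_ne_zero_of_hasBottomIndexExpZp D hc hz hMW)

/-- **S_sat(alt): `hcZp → z(𝟙) ∈ S_p(E/K) → (S_p(E/K) ≤ E(K) ⊗ ℤ_p) → S_{p,rel}(E/K) ≤ E(K) ⊗ ℤ_p`** — the
conclusion of `X12.O11.RamifiedCMBottomSaturationAt` at the frame of the datum, from the bottom index
exponent (a binder of the crux body `RamifiedCMBottomClassIndexLawAtZp`), [BKNO] Lemma 7.1 at `χ = 𝟙`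
(`z(𝟙)` crystalline at `𝔭`), and `T_pШ(E/K) = 0` in compact currency. The Poitou–Tate / «rank End_K ≤ 2»
/ Mattuck alternatives of the line card are not needed. [cite: BurungaleKobayashiNakamuraOta2026, §3.1.2, §3.3.1 and Lemma 7.1 (arXiv:2608.06879 pp. 16, 19, 40) (claim; preprint; shape only)]
[cite: PerrinRiou1987BSMF, §0 pp. 401–402 (`0 → E(L) ⊗ ℤ_p → S_p(L) → T_pШ → 0`)] -/
theorem relaxed_le_mordellWeilKummerSpan_of_hasBottomIndexExpZp
    (D : EllipticUnitClassData W p K 𝔭 κ γ ι φ Ω 𝓔) {c : ℕ} (hc : D.HasBottomIndexExpZp c)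
    (hz : D.z 0 ∈ (W.baseChange K).compactSelmerOver (κ.layerSubgroup 0) p)
    (hMW : (W.baseChange K).compactSelmerOver (κ.layerSubgroup 0) p ≤
      (W.baseChange K).mordellWeilKummerSpan p (κ.layerSubgroup 0)) :
    (W.baseChange K).relaxedCompactSelmerOver (κ.layerSubgroup 0) p {𝔭} ≤
      (W.baseChange K).mordellWeilKummerSpan p (κ.layerSubgroup 0) := by
  rw [relaxed_eq_compact_of_hasBottomIndexExpZp D hc hz hMW]
  exact hMW

/-- **S_sat(alt) with `z(𝟙) ∈ S_p(E/K)` discharged by [BKNO] Lemma 7.1 at `χ = 𝟙`** (the landed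
`BottomClass.bottom_mem_compactSelmerOver`, p446875, under its binder `hvan`: the central values
`L(φχ, 1)` of the level-`0` characters vanish — in analytic rank one with `φ` pinned to `W` this is
`L(E/ℚ, 1) = 0`): `hcZp → hvan → (S_p(E/K) ≤ E(K) ⊗ ℤ_p) → S_{p,rel}(E/K) ≤ E(K) ⊗ ℤ_p`.
[cite: BurungaleKobayashiNakamuraOta2026, Lemma 7.1 and Prop. 4.10 (arXiv:2608.06879 pp. 31, 40) (claim; preprint; shape only)]
[cite: PerrinRiou1987BSMF, §0 pp. 401–402] -/
theorem relaxed_le_mordellWeilKummerSpan_of_hasBottomIndexExpZp_of_hvan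
    (D : EllipticUnitClassData W p K 𝔭 κ γ ι φ Ω 𝓔) {c : ℕ} (hc : D.HasBottomIndexExpZp c)
    (hvan : ∀ (χ : HeckeCharacter K) (r : FramedGaloisRep K (PadicAlgCl p) 1),
      IsAcCharacter ι κ 0 χ r →
        ∃ hL : LFunction.HasEntireContinuation (heckeLFunction (φ * χ)), hL.continuation 1 = 0)
    (hMW : (W.baseChange K).compactSelmerOver (κ.layerSubgroup 0) p ≤
      (W.baseChange K).mordellWeilKummerSpan p (κ.layerSubgroup 0)) :
    (W.baseChange K).relaxedCompactSelmerOver (κ.layerSubgroup 0) p {𝔭} ≤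
      (W.baseChange K).mordellWeilKummerSpan p (κ.layerSubgroup 0) :=
  relaxed_le_mordellWeilKummerSpan_of_hasBottomIndexExpZp D hc
    (BottomClass.bottom_mem_compactSelmerOver D hvan) hMW

end Datum

end RelaxedEqCompact

end Summit.BirchSwinnertonDyer.BirchSwinnertonDyer.Theorems.RamifiedSevenEllipticUnits

end
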